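import Summits.NavierStokesRegularity.NavierStokesRegularity.Theorems.SoloRefuteGeorgievDavidi2024DeviceWitness

/-!
# C31b `GeorgievDavidi2024` — refutation of the compactness device p.2979 (`Step_L8_YCompact`), part 2/2

Cell `ns-claims` (D-0090 NS-CLAIMS SWEEP), claim C31b (Filomat 38:9 (2024) 2965–2982 [GeorgievDavidi2024]);
typed skeleton `Literature.Claims.NS.GeorgievDavidi2024` (p482552, typist-4 g2); lanes refuter-4 · ref-3 g2 ·
salvage-p1 g2. KIT written by the typist (ns-claims-typist-4 g2, sha16 f5d6f381adb61595) for the refuter lane (conv. (b)),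
adopted by the refuter of record ns-claims-refuter-4 (g0) after an independent farm check, with §3 (the sign clause
of `Y`) added by the refuter; the VERDICT/REF words are the refuter's/referee's.
Locator: p.2979 «Note that Y is a compact set in X» / «Y = Ỹ‾, U = {(u,v,w,p) ∈ Y : ‖(u,v,w,p)‖ < B}» and p.2980
«(I − S)(Ū) resides in a compact subset of Y» — the SECOND locator of C31b (the first is the statement of
Theorem 4.1 itself, `not_Theorem41` in `SoloRefuteGeorgievDavidi2024.lean`); it is what remains under the
referee's obvious charity (divergence-free data added to (P1)). Witness machinery in part 1
(`SoloRefuteGeorgievDavidi2024DeviceWitness.lean`).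

WHAT IS PROVED: `not_YCompact_nonneg` (§3: the same for the NON-NEGATIVE part of the ball, first printed form
of `Y` p.2979 l.77–86, via the shifted witness `1 + f w₁ n`) and `not_Step_L8_YCompact : ¬ Literature.Claims.NS.GeorgievDavidi2024.Step_L8_YCompact` — with
`B = 1` the sequence `f w₁ n (t,x) = ε n · sin(2π2ⁿ t) · φ(x)` (`φ` a bump at the origin, `ε n = c/(2π2ⁿ)`) lies in
`X¹` (`inX1_f`), satisfies `‖f w₁ n‖_{X¹} ≤ 1` (`x1NormLe_f`), and `|∂ₜ(f m − f n)(2^{−(m+1)}, 0)| ≥ c` for `m > n`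
(`sep`), so no subsequence is `‖·‖_{X¹}`-Cauchy. Class (refuter/referee to confirm): false lemma (countermodel),
the journal twin of C31's ADJUDICATED #38 locator.

Closed terms; axioms `propext`, `Classical.choice`, `Quot.sound`.

WHAT THIS IS NOT: not a claim about NS regularity or blow-up; not a claim about any author beyond the
typed locator.
-/

-- The summit's canonical theorem namespace repeats the summit name (single-conjunct summit).
set_option linter.dupNamespace false

noncomputable section

open scoped ContDiff
open Set MeasureTheory

namespace Summit.NavierStokesRegularity.NavierStokesRegularity.Theorems.GeorgievDavidi2024

open Literature.Claims.NS.GeorgievDavidi2021 (pd)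
open Literature.Claims.NS.GeorgievDavidi2024

/-! ## The separation: `∂ₜ(f m − f n)(2^{−(m+1)}, 0) ≤ −c` for `m > n` -/

/-- `2^{m+1} = 2·2^m`. -/
private lemma two_pow_succ' (m : ℕ) : (2 : ℝ) ^ (m + 1) = 2 * 2 ^ m := by ring

/-- `cos(fr m · 2^{−(m+1)}) = cos π = −1`. -/
lemma cos_fr_m (m : ℕ) : Real.cos (fr m * (1 / 2 ^ (m + 1))) = -1 := by
  have hne : (2 : ℝ) * 2 ^ m ≠ 0 := by positivity
  have : fr m * (1 / 2 ^ (m + 1)) = Real.pi := by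
    unfold fr
    rw [two_pow_succ', mul_one_div, show 2 * Real.pi * 2 ^ m = Real.pi * (2 * 2 ^ m) by ring,
      mul_div_assoc, div_self hne, mul_one]
  rw [this, Real.cos_pi]

/-- `fr n · 2^{−(m+1)} = π · 2ⁿ/2ᵐ`. -/
lemma fr_n_t0 (m n : ℕ) : fr n * (1 / 2 ^ (m + 1)) = Real.pi * (2 ^ n / 2 ^ m) := by
  unfold fr
  rw [two_pow_succ', mul_one_div, show 2 * Real.pi * (2 : ℝ) ^ n = (Real.pi * 2 ^ n) * 2 by ring,
    show (2 : ℝ) * 2 ^ m = 2 ^ m * 2 by ring, mul_div_mul_right _ _ (two_ne_zero), mul_div_assoc]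

/-- `cos(fr n · 2^{−(m+1)}) ≥ 0` for `n < m` (the argument lies in `[0, π/2]`). -/
lemma cos_fr_n_nonneg {m n : ℕ} (h : n < m) : 0 ≤ Real.cos (fr n * (1 / 2 ^ (m + 1))) := by
  rw [fr_n_t0]
  have hq0 : 0 ≤ (2 : ℝ) ^ n / 2 ^ m := by positivity
  have hq : (2 : ℝ) ^ n / 2 ^ m ≤ 1 / 2 := by
    rw [div_le_div_iff₀ (by positivity) (by norm_num), one_mul]
    have h1 : (2 : ℝ) ^ (n + 1) ≤ 2 ^ m := pow_le_pow_right₀ (by norm_num) (Nat.succ_le_of_lt h)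
    have h2 : (2 : ℝ) ^ (n + 1) = 2 ^ n * 2 := pow_succ 2 n
    linarith
  have hπ := Real.pi_pos
  apply Real.cos_nonneg_of_neg_pi_div_two_le_of_le
  · have : 0 ≤ Real.pi * (2 ^ n / 2 ^ m) := mul_nonneg hπ.le hq0
    linarith
  · calc Real.pi * (2 ^ n / 2 ^ m) ≤ Real.pi * (1 / 2) := mul_le_mul_of_nonneg_left hq hπ.le
      _ = Real.pi / 2 := by ring

/-- `t₀ = 2^{−(m+1)} ∈ [0, ∞) = [w₁.a, ∞)`. -/
lemma t0_mem (m : ℕ) : (1 : ℝ) / 2 ^ (m + 1) ∈ Ici w₁.a := by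
  rw [w₁_a]; exact Set.mem_Ici.mpr (by positivity)

/-- At `t₀ = 2^{−(m+1)}`, `x = 0`: `|∂ₜ(f m − f n)| ≥ c` whenever `n < m` (one-sided derivative on `[0,∞)`). -/
lemma sep {m n : ℕ} (h : n < m) :
    c w₁ ≤ |derivWithin (fun s => f w₁ m s 0 - f w₁ n s 0) (Ici 0) (1 / 2 ^ (m + 1))| := by
  have hI : Ici (0 : ℝ) = Ici w₁.a := by rw [w₁_a]
  have hx : (0 : EuclideanSpace ℝ (Fin 3)) = w₁.x₀ := rfl
  rw [hI, hx, derivWithin_f_sub_Ici w₁ m n w₁.x₀ (t0_mem m), φ_centre, w₁_R, w₁_a]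
  simp only [mul_one, one_mul, sub_zero]
  rw [cos_fr_m]
  have hcos := cos_fr_n_nonneg h
  have hc : 0 < c w₁ := c_pos w₁
  have hle : c w₁ * -1 - c w₁ * Real.cos (fr n * (1 / 2 ^ (m + 1))) ≤ -(c w₁) := by nlinarith
  exact le_abs.mpr (Or.inr (by linarith))

/-! ## The refutation of the device -/

/-- **The compactness device p.2979 is false** (`Step_L8_YCompact` of the skeleton): the sequence
`f w₁ n (t,x) = ε n · sin(2π2ⁿ t) · φ(x)` lies in `X¹`, has all eight `X¹`-sups `≤ 1` on `[0,∞) × ℝ³`, and has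
NO `‖·‖_{X¹}`-Cauchy subsequence: for `m > n`, `|∂ₜ(f m − f n)(2^{−(m+1)}, 0)| ≥ c`, against the Cauchy bound
`c/2` (Riesz: the `B`-ball of the infinite-dimensional normed space `X¹` is not relatively compact; «equi-continuous
families» are not elements of `X`, and Arzelà–Ascoli would need equicontinuity of `u_t` and of the second
derivatives on the non-compact `[0,∞) × ℝ³`). [cite: GeorgievDavidi2024, §4.1 p.2979 (L8), p.2980 (L9)] -/
theorem not_Step_L8_YCompact : ¬ Step_L8_YCompact := by
  intro h
  obtain ⟨σ, hσ, hcauchy⟩ := h 1 one_pos (f w₁) inX1_f x1NormLe_f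
  obtain ⟨N, hN⟩ := hcauchy (c w₁ / 2) (half_pos (c_pos w₁))
  have hlt : σ N < σ (N + 1) := hσ (Nat.lt_succ_self N)
  have hle := hN (N + 1) N (Nat.le_succ N) le_rfl
  have ht0 : (0 : ℝ) ≤ 1 / 2 ^ (σ (N + 1) + 1) := by positivity
  obtain ⟨-, hdt, -⟩ := hle (1 / 2 ^ (σ (N + 1) + 1)) ht0 0
  have hsep := sep hlt
  linarith [c_pos w₁]

/-! ## §3 (refuter-4) The sign clause of the first printed form of `Y` does not rescue the device

p.2979 l.77–86 defines `Y = {(u,v,w,p) ∈ Ỹ₁ : (u,v,w,p) ≥ 0, ‖(u,v,w,p)‖ ≤ B}` before «Note that `Y` is a compact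
set in `X`» (the second form, l.92–94, has no sign clause). The shifted witness `1 + f w₁ n` is NON-NEGATIVE on
`[0,∞) × ℝ³`, lies in `X¹` with all eight sups `≤ 2`, and has the same differences as `f w₁ n` — so the
non-negative part of the `2`-ball of `X¹` is not relatively sequentially compact either. -/

/-- The shifted witness `1 + f w₁ n`. -/
def fsh (n : ℕ) (t : ℝ) : EuclideanSpace ℝ (Fin 3) → ℝ := fun x => 1 + f w₁ n t x

/-- Space derivatives ignore the shift. -/
lemma pd_fsh (k : Fin 3) (n : ℕ) (t : ℝ) : pd k (fsh n t) = pd k (f w₁ n t) := by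
  funext x
  simp only [pd]
  rw [show fsh n t = fun x => 1 + f w₁ n t x from rfl, fderiv_const_add]

/-- One-sided time derivatives ignore the shift. -/
lemma derivWithin_fsh (n : ℕ) (x : EuclideanSpace ℝ (Fin 3)) (t : ℝ) :
    derivWithin (fun s => fsh n s x) (Ici 0) t = derivWithin (fun s => f w₁ n s x) (Ici 0) t := by
  simp only [fsh]
  exact derivWithin_const_add (f := fun s => f w₁ n s x) 1

/-- Every `1 + f w₁ n` lies in `X¹`. -/
lemma inX1_fsh (n : ℕ) : InX1 (fsh n) where
  c1 := contDiffOn_const.add (inX1_f n).c1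
  c2 := fun t ht => contDiff_const.add ((inX1_f n).c2 t ht)
  cont1 := fun k => by
    simp_rw [pd_fsh]
    exact (inX1_f n).cont1 k
  cont2 := fun k => by
    simp_rw [pd_fsh]
    exact (inX1_f n).cont2 k

/-- `‖1 + f w₁ n‖_{X¹} ≤ 2`. -/
lemma x1NormLe_fsh (n : ℕ) : X1NormLe (fsh n) 2 := by
  intro t ht x
  obtain ⟨h0, h1, h2⟩ := x1NormLe_f n t ht x
  have h0' := abs_le.mp h0
  refine ⟨?_, ?_, fun k => ?_⟩
  · simp only [fsh]
    rw [abs_le]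
    constructor <;> linarith [h0'.1, h0'.2]
  · rw [derivWithin_fsh]
    linarith
  · obtain ⟨h3, h4⟩ := h2 k
    rw [pd_fsh]
    exact ⟨by linarith, by linarith⟩

/-- `1 + f w₁ n ≥ 0` on `[0,∞) × ℝ³`. -/
lemma fsh_nonneg (n : ℕ) (t : ℝ) (ht : 0 ≤ t) (x : EuclideanSpace ℝ (Fin 3)) : 0 ≤ fsh n t x := by
  have h := (abs_le.mp (x1NormLe_f n t ht x).1).1
  simp only [fsh]
  linarith

/-- The shift cancels in differences. -/
lemma fsh_sub (m n : ℕ) :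
    (fun t x => fsh m t x - fsh n t x) = fun t x => f w₁ m t x - f w₁ n t x := by
  funext t x
  simp only [fsh]
  ring

/-- **The device is false even for the non-negative part of the ball** (first printed form of `Y`, p.2979
l.77–86): there is no `‖·‖_{X¹}`-Cauchy subsequence of the non-negative, `X¹`-bounded sequence `1 + f w₁ n`.
[cite: GeorgievDavidi2024, §4.1 p.2979 (L8)] -/
theorem not_YCompact_nonneg :
    ¬ (∀ B : ℝ, 0 < B → ∀ g : ℕ → ℝ → EuclideanSpace ℝ (Fin 3) → ℝ, (∀ n, InX1 (g n)) →
        (∀ n, X1NormLe (g n) B) → (∀ n t, 0 ≤ t → ∀ x, 0 ≤ g n t x) → HasX1CauchySubseq g) := by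
  intro h
  obtain ⟨σ, hσ, hcauchy⟩ := h 2 two_pos fsh inX1_fsh x1NormLe_fsh fsh_nonneg
  obtain ⟨N, hN⟩ := hcauchy (c w₁ / 2) (half_pos (c_pos w₁))
  have hlt : σ N < σ (N + 1) := hσ (Nat.lt_succ_self N)
  have hle := hN (N + 1) N (Nat.le_succ N) le_rfl
  rw [fsh_sub] at hle
  have ht0 : (0 : ℝ) ≤ 1 / 2 ^ (σ (N + 1) + 1) := by positivity
  obtain ⟨-, hdt, -⟩ := hle (1 / 2 ^ (σ (N + 1) + 1)) ht0 0
  have hsep := sep hlt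
  linarith [c_pos w₁]

end Summit.NavierStokesRegularity.NavierStokesRegularity.Theorems.GeorgievDavidi2024

end
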